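import Literature.NumberTheory.EllipticCurves.WeilPairingDivisors
import Literature.NumberTheory.EllipticCurves.WeilPairing
import Literature.NumberTheory.EllipticCurves.GaloisActionProofs
import Literature.NumberTheory.EllipticCurves.PointDivisibilityProofs
import Literature.NumberTheory.GaloisRepresentations.AbsGaloisGroup
import HarnessLib

/-!
# The Weil pairing on `E[m]` exists: proof of `WeierstrassCurve.exists_weilPairing`

Topic `NumberTheory/EllipticCurves`; the `…Proofs` sibling (D-0014 append protocol) of
`Literature.NumberTheory.EllipticCurves.WeilPairing`, whose named fact
`WeierstrassCurve.exists_weilPairing W m` (Silverman, *AEC*, III.8, Prop. 8.1 (a)–(d): on the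
`m`-torsion `E[m] = E(F̄)[m]` of an elliptic curve `E = W` over a field `F` with `char F ∤ m` there
is a pairing with values in `μ_m` which is bilinear, alternating, non-degenerate and Galois
equivariant) is **proved** here: `WeierstrassCurve.exists_weilPairing_holds`. This discharges one of
the three leaves of the decomposition of the Modularity Theorem in
`Literature.NumberTheory.Automorphic.BCDTModularity` (`det ρ̄_{E,5} = χ̄_5`, via
`det_eq_modPCyclotomicCharacter_of_isTorsionGaloisRep_of_exists_weilPairing`) and an input of
`Literature.NumberTheory.EllipticCurves.TateModuleDeterminantProofs`.

## The construction and the proof (Silverman, *AEC*, III.§8, pp. 92–95, reorganised)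

Let `G = E[m] ⊆ E(F̄)` (`#G = m²`, the tree's `card_torsionPoints_eq_sq_holds`) and, for `T ∈ G`,
choose `T'` with `m T' = T` (`[m]` is onto, the tree's `zsmul_geomPoints_surjective_holds`).
Silverman takes `f` with `div f = m(T) - m(O)`, `g` with `g^m = f ∘ [m]`, notes
`div g = Σ_{R ∈ G} (T' + R) - (R)`, and puts `e_m(S, T) = g(X + S)/g(X)`. Here `g` is introduced
directly through its divisor: a **Weil function for `T`** (`IsWeilFunction`) is `h ∈ F̄(E)^×` with
`ord_P h = 𝟙_G(P - T') - 𝟙_G(P)` for some `T'` with `mT' = T` (`𝟙_G` = `torsionInd`); it exists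
because that divisor has degree `0` and sum `#G · T' = m² T' = O` (*AEC* Cor. III.3.5, the tree's
`exists_ord_eq_of_pairs` of `WeilPairingDivisors`), and is unique up to `F̄^×` (two roots `T'`
differ by an element of `G`). Then:

* `e(S, T) := τ_S^* h / h ∈ F̄^×` for `S ∈ G` (`weilPairingFun`; `div h` is `G`-invariant and
  functions with the same divisor are proportional, `ord_transAlgHom` and
  `exists_eq_smul_of_ord_eq` of `WeilPairingDivisors`); it does not depend on the choice of `h`
  (`IsWeilFunction.transAlgHom_eq`). This is Silverman's `g(X + S)/g(X)` (p. 94).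
* **(a), linear in `S`**: `τ_{S₁+S₂}^* = τ_{S₁}^* τ_{S₂}^*` (`weilPairingFun_add_left`); hence
  `e(S,T)^m = e(mS, T) = e(O, T) = 1` (`weilPairingFun_pow`): values in `μ_m`.
* **(a), linear in `T`** (`weilPairingFun_add_right`): for Weil functions `h₁, h₂` of `T₁, T₂`
  with roots `T₁', T₂'` and `w` with `div w = (T₁' + T₂') - (T₁') - (T₂') + (O)`, the product
  `h₁ h₂ N(w)`, `N(w) = ∏_{R ∈ G} τ_R^* w`, is a Weil function for `T₁ + T₂` and `N(w)` is
  `G`-invariant (`exists_isWeilFunction_add`; Silverman instead uses `h ∘ [m]` with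
  `div h = (T₁+T₂) - (T₁) - (T₂) + (O)`, p. 94, which needs the pull-back of divisors along `[m]`).
* **(b), `e(T, T) = 1`** (`weilPairingFun_self`): as printed (p. 94), `H = ∏_{i<m} τ_{iT'}^* h` has
  divisor `0` (a telescoping sum), so is constant, and `τ_{T'}^* H = H · τ_T^* h / h`.
* **(c), non-degeneracy** (`eq_zero_of_weilPairingFun_eq_one`): as printed (p. 94–95): if
  `τ_S^* h = h` for all `S ∈ G` then `h ∈ F̄(E)^G = [m]^* F̄(E)` (*AEC* III.4.10(b); the tree's
  `Isogeny.pullbackField_zsmul_eq_fixedField` of `IsogenyFactorProofs`), `h = [m]^* Fn`, and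
  comparing orders along `[m]` (`exists_ord_pullbackHom_zsmul`) gives `div Fn = (T) - (O)`, so
  `T = O` (*AEC* Prop. III.3.3 / Cor. III.3.5; `eq_zero_of_ord_eq_single`).
* **(d), Galois equivariance** (`weilPairingFun_smul`): `σ ∈ Γ_F` acts on `F̄(E)` through the
  coefficients (`galFunctionField`, Section 1 of this file), `σ̃ h` is a Weil function for `σ T`
  (`ord_{σP}(σ̃ h) = ord_P(h)`), and `σ̃ τ_S^* = τ_{σS}^* σ̃`; apply `σ̃` to `τ_S^* h = e(S,T) h`.

Section 1 (the `Γ_F`-action on `F̄[E]` and `F̄(E)`, Silverman *AEC* I.§1–2 and II.§2: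
`f^σ`, `(f^σ)(P^σ) = f(P)^σ`, `ord_{P^σ}(f^σ) = ord_P(f)`) is general and independent of the Weil
pairing: `galCoordRing σ`, `galFunctionField σ` (real definitions: `Ideal.quotientEquiv` of the
coefficientwise action, which fixes the Weierstrass polynomial of `E/F`, and its extension to the
fraction field), `HasValueAt.galFunctionField`, `pointComap_galFunctionField`,
`ord_galFunctionField`, `galFunctionField_transAlgHom`.

## Faithfulness

The theorem proved is literally the tree's `def exists_weilPairing` (nothing weakened); its
hypothesis `[PerfectField F]` is not used. The pairing constructed is Silverman's `e_m` up to the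
normalisation of `g` (which cancels in `g(X+S)/g(X)`), i.e. it *is* the Weil pairing, although
the named fact only asks for existence.

## References

* [SilvermanAEC2009] J. H. Silverman, *The Arithmetic of Elliptic Curves*, 2nd ed., GTM 106,
  Springer 2009: III.§8 pp. 92–95, **Prop. III.8.1 (a)–(d)** and its proof; Cor. III.3.5,
  Prop. III.3.3, Thm. III.4.10(b), Cor. III.6.4(b); I.§1–2, II.§2 (Galois action on `K̄(V)`).
* [SilvermanCSS1997] J. H. Silverman, in Cornell–Silverman–Stevens, *Modular Forms and Fermat's
  Last Theorem* (1997), Ch. II §8 (the same construction).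

## Design

`noncomputable section`, `open scoped Classical`, universe `u`, dot-notation extensions in
`namespace WeierstrassCurve`. The level `m : ℕ` and the hypothesis `hm : (m : F) ≠ 0` are threaded
explicitly (`include hm`); `weilFn hm hT` / `weilPairingFun hm S T` depend on `hm` through the
finiteness of `E[m]`. `weilPairingFun` has the junk value `1` off `E[m] × E[m]`.
-/

noncomputable section

open scoped Classical
open scoped Polynomial.Bivariate WithZero
open Polynomial IsDedekindDomain

universe u

/-! # Section 1. The action of `Γ_K` on `K̄[E]` and `K̄(E)` -/

namespace WeierstrassCurve

open geomPoints Literature.NumberTheory.EllipticCurves.WeierstrassFunctionField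

variable {K : Type u} [Field K] (W : WeierstrassCurve K)

/-! ## `σ ∈ Γ_K` acting on `K̄[E]` and `K̄(E)` through the coefficients -/

section Defs

/-- `σ ∈ Γ_K` as a `K`-algebra automorphism of `K̄` (the tree's identification
`Field.absoluteGaloisGroup.toAlgEquiv`). [folklore] -/
abbrev galAlgEquiv (σ : Field.absoluteGaloisGroup K) :
    AlgebraicClosure K ≃ₐ[K] AlgebraicClosure K :=
  Field.absoluteGaloisGroup.toAlgEquiv K σ

/-- The ring endomorphism of `K̄` underlying `σ ∈ Γ_K` (definitionally Mathlib's
`MulSemiringAction.toRingHom (Field.absoluteGaloisGroup K) (AlgebraicClosure K) σ` for the tree's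
action of `Γ_K` on `K̄`; written as a coercion so that `map_baseChange` applies). [folklore] -/
abbrev galRingHom (σ : Field.absoluteGaloisGroup K) : AlgebraicClosure K →+* AlgebraicClosure K :=
  ((galAlgEquiv σ : AlgebraicClosure K →ₐ[K] AlgebraicClosure K) :
    AlgebraicClosure K →+* AlgebraicClosure K)

/-- `galRingHom σ` acts as `σ`. [folklore] -/
theorem galRingHom_apply (σ : Field.absoluteGaloisGroup K) (x : AlgebraicClosure K) :
    galRingHom σ x = σ • x :=
  rfl

/-- `galRingHom (σ τ) = galRingHom σ ∘ galRingHom τ` pointwise. [folklore] -/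
theorem galRingHom_mul_apply (σ τ : Field.absoluteGaloisGroup K) (x : AlgebraicClosure K) :
    galRingHom (σ * τ) x = galRingHom σ (galRingHom τ x) :=
  rfl

/-- The Weierstrass polynomial of `E / K̄` is fixed by `σ ∈ Γ_K` acting on coefficients (it has
coefficients in `K`). [folklore] -/
theorem map_mapRingHom_polynomial (σ : Field.absoluteGaloisGroup K) :
    (W.baseChange (AlgebraicClosure K)).toAffine.polynomial.map (mapRingHom (galRingHom σ)) =
      (W.baseChange (AlgebraicClosure K)).toAffine.polynomial := by
  rw [← Affine.map_polynomial]
  show ((W.baseChange (AlgebraicClosure K)).map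
    ((galAlgEquiv σ : AlgebraicClosure K →ₐ[K] AlgebraicClosure K) :
      AlgebraicClosure K →+* AlgebraicClosure K)).toAffine.polynomial = _
  rw [map_baseChange]

/-- The coefficientwise action of `σ` on `K̄[X][Y]` as an iterated `Polynomial.mapEquiv`.
[folklore] -/
theorem mapEquiv_mapEquiv_apply (σ : Field.absoluteGaloisGroup K) (p : (AlgebraicClosure K)[X][Y]) :
    mapEquiv (mapEquiv ((galAlgEquiv σ).toRingEquiv)) p = p.map (mapRingHom (galRingHom σ)) := by
  ext n m
  simp only [mapEquiv_apply, coeff_map, coe_mapRingHom, RingEquiv.coe_toRingHom]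
  rfl

/-- **`σ ∈ Γ_K` acting on the coordinate ring `K̄[E] = K̄[X, Y]/(W)`** through the coefficients
(`E` is defined over `K`, so the ideal `(W)` is stable). Silverman, *AEC*, I.§1–2 and II.§2
(`G_{K̄/K}` acts on `K̄[V]` and `K̄(V)` for `V/K`; `f(P)^σ = f^σ(P^σ)`). [folklore] -/
def galCoordRing (σ : Field.absoluteGaloisGroup K) : W.geomCoordRing ≃+* W.geomCoordRing :=
  Ideal.quotientEquiv (Ideal.span {(W.baseChange (AlgebraicClosure K)).toAffine.polynomial})
    (Ideal.span {(W.baseChange (AlgebraicClosure K)).toAffine.polynomial})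
    (mapEquiv (mapEquiv ((galAlgEquiv σ).toRingEquiv)))
    (by
      rw [Ideal.map_span, Set.image_singleton, RingEquiv.coe_toRingHom, mapEquiv_mapEquiv_apply,
        map_mapRingHom_polynomial])

/-- `σ` acts on the class of `p(X, Y)` by acting on the coefficients of `p`. [folklore] -/
theorem galCoordRing_mk (σ : Field.absoluteGaloisGroup K) (p : (AlgebraicClosure K)[X][Y]) :
    W.galCoordRing σ (AdjoinRoot.mk _ p) =
      AdjoinRoot.mk _ (p.map (mapRingHom (galRingHom σ))) :=
  rfl

/-- `σ` acts on constants of `K̄[E]` by `σ`. [folklore] -/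
theorem galCoordRing_algebraMap (σ : Field.absoluteGaloisGroup K) (c : AlgebraicClosure K) :
    W.galCoordRing σ (algebraMap (AlgebraicClosure K) W.geomCoordRing c) =
      algebraMap (AlgebraicClosure K) W.geomCoordRing (galRingHom σ c) := by
  change W.galCoordRing σ (AdjoinRoot.mk _ (C (C c))) = AdjoinRoot.mk _ (C (C (galRingHom σ c)))
  rw [galCoordRing_mk, Polynomial.map_C, coe_mapRingHom, Polynomial.map_C]

/-- **`σ ∈ Γ_K` acting on the function field `K̄(E)`** (the extension of the action on `K̄[E]` to
its fraction field). Silverman, *AEC*, I.§1–2, II.§2. [folklore] -/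
def galFunctionField (σ : Field.absoluteGaloisGroup K) :
    W.geomFunctionField ≃+* W.geomFunctionField :=
  IsFractionRing.ringEquivOfRingEquiv (W.galCoordRing σ)

/-- `σ̃` extends the action on `K̄[E]`. [folklore] -/
theorem galFunctionField_algebraMap (σ : Field.absoluteGaloisGroup K) (r : W.geomCoordRing) :
    W.galFunctionField σ (algebraMap W.geomCoordRing W.geomFunctionField r) =
      algebraMap W.geomCoordRing W.geomFunctionField (W.galCoordRing σ r) :=
  IsFractionRing.ringEquivOfRingEquiv_algebraMap _ r

/-- **`σ̃` acts on the constants `K̄ ⊆ K̄(E)` as `σ`.** [folklore] -/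
theorem galFunctionField_algebraMap_base (σ : Field.absoluteGaloisGroup K) (c : AlgebraicClosure K) :
    W.galFunctionField σ (algebraMap (AlgebraicClosure K) W.geomFunctionField c) =
      algebraMap (AlgebraicClosure K) W.geomFunctionField (galRingHom σ c) := by
  rw [IsScalarTower.algebraMap_apply (AlgebraicClosure K) W.geomCoordRing W.geomFunctionField,
    galFunctionField_algebraMap, galCoordRing_algebraMap, ← IsScalarTower.algebraMap_apply]

/-- **`σ̃ x = x`.** [folklore] -/
theorem galFunctionField_genX (σ : Field.absoluteGaloisGroup K) :
    W.galFunctionField σ W.genX = W.genX := by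
  change W.galFunctionField σ (algebraMap W.geomCoordRing W.geomFunctionField
    (AdjoinRoot.mk _ (C X))) = algebraMap W.geomCoordRing W.geomFunctionField (AdjoinRoot.mk _ (C X))
  rw [galFunctionField_algebraMap, galCoordRing_mk, Polynomial.map_C, coe_mapRingHom,
    Polynomial.map_X]

/-- **`σ̃ y = y`.** [folklore] -/
theorem galFunctionField_genY (σ : Field.absoluteGaloisGroup K) :
    W.galFunctionField σ W.genY = W.genY := by
  change W.galFunctionField σ (algebraMap W.geomCoordRing W.geomFunctionField (AdjoinRoot.mk _ Y)) =
    algebraMap W.geomCoordRing W.geomFunctionField (AdjoinRoot.mk _ Y)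
  rw [galFunctionField_algebraMap, galCoordRing_mk, Polynomial.map_X]

/-- `σ̃⁻¹` acts on constants as `σ⁻¹`. [folklore] -/
theorem galFunctionField_symm_algebraMap_base (σ : Field.absoluteGaloisGroup K)
    (c : AlgebraicClosure K) :
    (W.galFunctionField σ).symm (algebraMap (AlgebraicClosure K) W.geomFunctionField c) =
      algebraMap (AlgebraicClosure K) W.geomFunctionField (galRingHom σ⁻¹ c) := by
  rw [RingEquiv.symm_apply_eq, galFunctionField_algebraMap_base, ← galRingHom_mul_apply,
    mul_inv_cancel, galRingHom_apply, one_smul]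

/-- `σ̃⁻¹ x = x`. [folklore] -/
theorem galFunctionField_symm_genX (σ : Field.absoluteGaloisGroup K) :
    (W.galFunctionField σ).symm W.genX = W.genX := by
  rw [RingEquiv.symm_apply_eq, galFunctionField_genX]

/-- `σ̃⁻¹ y = y`. [folklore] -/
theorem galFunctionField_symm_genY (σ : Field.absoluteGaloisGroup K) :
    (W.galFunctionField σ).symm W.genY = W.genY := by
  rw [RingEquiv.symm_apply_eq, galFunctionField_genY]

/-- `σ̃` preserves constants (maps `K̄` onto `K̄`). [folklore] -/
theorem preservesConstants_galFunctionField (σ : Field.absoluteGaloisGroup K) :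
    W.PreservesConstants (W.galFunctionField σ) :=
  fun c ↦ ⟨galRingHom σ c, W.galFunctionField_algebraMap_base σ c⟩

/-- Compatibility of Mathlib's `K̄[X][Y] ≃ K̄[x₀, x₁]` with a change of coefficients. [folklore] -/
theorem equivMvPolynomial_map_mapRingHom {k : Type*} [CommRing k] (f : k →+* k) (p : k[X][Y]) :
    Polynomial.Bivariate.equivMvPolynomial k (p.map (mapRingHom f)) =
      MvPolynomial.map f (Polynomial.Bivariate.equivMvPolynomial k p) := by
  have h : ((Polynomial.Bivariate.equivMvPolynomial k : k[X][Y] ≃ₐ[k] MvPolynomial (Fin 2) k) :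
      k[X][Y] →+* MvPolynomial (Fin 2) k).comp (mapRingHom (mapRingHom f)) =
      (MvPolynomial.map f).comp (Polynomial.Bivariate.equivMvPolynomial k :
        k[X][Y] →+* MvPolynomial (Fin 2) k) := by
    refine Polynomial.ringHom_ext' (Polynomial.ringHom_ext (fun c ↦ ?_) ?_) ?_
    · simp [Polynomial.Bivariate.equivMvPolynomial_C_C]
    · simp [Polynomial.Bivariate.equivMvPolynomial_C_X]
    · simp [Polynomial.Bivariate.equivMvPolynomial_X]
  exact RingHom.congr_fun h p

/-- **`σ̃ (g(x, y)) = g^σ(x, y)`**: on the image of `K̄[x₀, x₁]` under evaluation at the generic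
point, `σ̃` acts on the coefficients. [folklore] -/
theorem galFunctionField_evalGeneric (σ : Field.absoluteGaloisGroup K)
    (g : MvPolynomial (Fin 2) (AlgebraicClosure K)) :
    W.galFunctionField σ (W.evalGeneric g) = W.evalGeneric (MvPolynomial.map (galRingHom σ) g) := by
  set e := Polynomial.Bivariate.equivMvPolynomial (AlgebraicClosure K)
  change W.galFunctionField σ (algebraMap W.geomCoordRing W.geomFunctionField
    (AdjoinRoot.mk _ (e.symm g))) =
    algebraMap W.geomCoordRing W.geomFunctionField (AdjoinRoot.mk _ (e.symm _))
  rw [galFunctionField_algebraMap, galCoordRing_mk]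
  congr 2
  apply e.injective
  rw [equivMvPolynomial_map_mapRingHom, e.apply_symm_apply, e.apply_symm_apply]

end Defs

/-! ## `σ̃` and values: `(σ̃ z)(σ P) = σ (z(P))` -/

section Values

variable {W}

/-- Coordinates of `σ • P` are `σ` of the coordinates of `P`. [folklore] -/
theorem xy_smul (σ : Field.absoluteGaloisGroup K) (P : W.geomPoints) :
    xy (σ • P) = galRingHom σ ∘ xy P := by
  cases P with
  | zero =>
    change xy (σ • (0 : W.geomPoints)) = galRingHom σ ∘ (0 : Fin 2 → AlgebraicClosure K)
    rw [smul_zero, xy_zero]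
    ext i; simp
  | some a b h =>
    change xy (Affine.Point.map (galAlgEquiv σ : AlgebraicClosure K →ₐ[K] AlgebraicClosure K)
      (Affine.Point.some a b h)) = galRingHom σ ∘ ![a, b]
    rw [Affine.Point.map_some, xy_some]
    ext i; fin_cases i <;> rfl

/-- **`(σ̃ z)(σ P) = σ(z(P))`**: `σ̃` transports values (Silverman, *AEC*, I.§1–2, II.§2:
`f(P)^σ = f^σ(P^σ)`). [folklore] -/
theorem HasValueAt.galFunctionField {z : W.geomFunctionField} {P : W.geomPoints}
    {c : AlgebraicClosure K} (hz : W.HasValueAt z P c) (σ : Field.absoluteGaloisGroup K) :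
    W.HasValueAt (W.galFunctionField σ z) (σ • P) (galRingHom σ c) := by
  obtain ⟨g, h, hh, hzg, hval⟩ := hz
  refine ⟨MvPolynomial.map (galRingHom σ) g, MvPolynomial.map (galRingHom σ) h, ?_, ?_, ?_⟩
  · rw [xy_smul, ← MvPolynomial.map_eval, map_ne_zero_iff _ (galRingHom σ).injective]
    exact hh
  · rw [← galFunctionField_evalGeneric, ← galFunctionField_evalGeneric, ← map_mul, hzg]
  · rw [xy_smul, ← MvPolynomial.map_eval, ← MvPolynomial.map_eval, hval, map_mul]

end Values

/-! ## `σ̃` permutes the places as `σ` permutes the points; `ord_{σP}(σ̃ u) = ord_P(u)` -/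

section Places

variable {W} [W.IsElliptic]

/-- **`σ̃` maps the local ring at `P` onto the local ring at `σ P`**: in the notation of
`WeilPairingDivisors`, `pointComap σ̃ (σ • P) = P`, i.e. `{z : σ̃ z ∈ K̄[E]_{σP}} = K̄[E]_P`.
Silverman, *AEC*, II.§2. [folklore] -/
theorem pointComap_galFunctionField (σ : Field.absoluteGaloisGroup K) (P : W.geomPoints) :
    W.pointComap (W.galFunctionField σ) (σ • P) = P := by
  rcases eq_or_ne P 0 with rfl | hP
  · -- the place at infinity: `x ∉ {z : σ̃ z ∈ O_∞}` since `σ̃ x = x`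
    apply place_injective
    rw [place_pointComap (W.preservesConstants_galFunctionField σ), smul_zero, place_zero]
    refine Literature.NumberTheory.DiophantineGeometry.WeierstrassPlaces.eq_infPlace _ ?_
    rw [mem_placeComap_iff]
    change W.galFunctionField σ W.genX ∉ (W.place 0).toValuationSubring
    rw [galFunctionField_genX, place_zero]
    exact Literature.NumberTheory.DiophantineGeometry.WeierstrassPlaceAtInfinity.x_not_mem_infPlace _
  · have hσP : σ • P ≠ 0 := fun h ↦ hP (by
      have := congrArg (σ⁻¹ • ·) h
      simpa using this)
    refine pointComap_eq_of_le (W.preservesConstants_galFunctionField σ) fun z hz ↦ ?_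
    rw [mem_placeComap_iff]
    obtain ⟨c, hc⟩ := exists_hasValueAt_of_mem_place hP hz
    exact ((hc.galFunctionField σ).mem_place hσP).1

/-- **`v_{σP} (σ̃ u) = v_P (u)`.** Silverman, *AEC*, II.§2 (`ord_{P^σ}(f^σ) = ord_P(f)`).
[folklore] -/
theorem placeValuation_galFunctionField (σ : Field.absoluteGaloisGroup K) (P : W.geomPoints)
    (u : W.geomFunctionField) :
    placeValuation (W.baseChange (AlgebraicClosure K)).toAffine (σ • P) (W.galFunctionField σ u) =
      placeValuation (W.baseChange (AlgebraicClosure K)).toAffine P u := by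
  rw [← placeValuation_pointComap (W.preservesConstants_galFunctionField σ),
    pointComap_galFunctionField]

/-- **`ord_{σP} (σ̃ u) = ord_P (u)`.** Silverman, *AEC*, II.§2. [folklore] -/
theorem ord_galFunctionField (σ : Field.absoluteGaloisGroup K) (P : W.geomPoints)
    (u : W.geomFunctionField) :
    ord (W.baseChange (AlgebraicClosure K)).toAffine (σ • P) (W.galFunctionField σ u) =
      ord (W.baseChange (AlgebraicClosure K)).toAffine P u := by
  simp only [ord, placeValuation_galFunctionField]

end Places

/-! ## `σ̃ ∘ τ_T^* = τ_{σT}^* ∘ σ̃` -/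

section Translations

variable {W}

/-- `σ̃` as a `K`-algebra automorphism of `K̄(E)` (it fixes `K`). [folklore] -/
def galFunctionFieldAlgEquiv (σ : Field.absoluteGaloisGroup K) :
    W.geomFunctionField ≃ₐ[K] W.geomFunctionField :=
  { W.galFunctionField σ with
    commutes' := fun c ↦ by
      change W.galFunctionField σ (algebraMap K W.geomFunctionField c) = _
      rw [IsScalarTower.algebraMap_apply K (AlgebraicClosure K) W.geomFunctionField,
        galFunctionField_algebraMap_base]
      congr 1
      exact AlgEquiv.commutes (galAlgEquiv σ) c }

/-- `galFunctionFieldAlgEquiv` acts as `galFunctionField`. [folklore] -/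
@[simp] theorem galFunctionFieldAlgEquiv_apply (σ : Field.absoluteGaloisGroup K)
    (z : W.geomFunctionField) : W.galFunctionFieldAlgEquiv σ z = W.galFunctionField σ z :=
  rfl

variable [W.IsElliptic]

/-- `σ̃` fixes the generic point of `E(K̄(E))`. [folklore] -/
theorem map_galFunctionFieldAlgEquiv_genericPoint (σ : Field.absoluteGaloisGroup K) :
    Affine.Point.map (W' := W) (W.galFunctionFieldAlgEquiv σ : W.geomFunctionField →ₐ[K]
      W.geomFunctionField) W.genericPoint = W.genericPoint := by
  rw [genericPoint, Affine.Point.map_some]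
  simp only [Affine.Point.some.injEq]
  exact ⟨W.galFunctionField_genX σ, W.galFunctionField_genY σ⟩

omit [W.IsElliptic] in
/-- `σ̃` maps the constant point `T` to the constant point `σ T`. [folklore] -/
theorem map_galFunctionFieldAlgEquiv_constPoint (σ : Field.absoluteGaloisGroup K)
    (T : W.geomPoints) :
    Affine.Point.map (W' := W) (W.galFunctionFieldAlgEquiv σ : W.geomFunctionField →ₐ[K]
      W.geomFunctionField) (W.constPoint T) = W.constPoint (σ • T) := by
  cases T with
  | zero =>
    change Affine.Point.map _ (W.constPoint 0) = W.constPoint (σ • (0 : W.geomPoints))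
    rw [smul_zero, map_zero, map_zero]
  | some a b h =>
    change _ = W.constPoint (Affine.Point.map (galAlgEquiv σ : AlgebraicClosure K →ₐ[K]
      AlgebraicClosure K) (Affine.Point.some a b h))
    rw [Affine.Point.map_some, constPoint_some, constPoint_some, Affine.Point.map_some]
    simp only [Affine.Point.some.injEq]
    exact ⟨W.galFunctionField_algebraMap_base σ a, W.galFunctionField_algebraMap_base σ b⟩

/-- The `K̄`-algebra endomorphism `σ̃ ∘ τ_T^* ∘ σ̃⁻¹` of `K̄(E)` (proof-local device for
`galFunctionField_transAlgHom`). [folklore] -/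
private def conjTransAlgHom (σ : Field.absoluteGaloisGroup K) (T : W.geomPoints) :
    W.geomFunctionField →ₐ[AlgebraicClosure K] W.geomFunctionField :=
  { ((W.galFunctionField σ).toRingHom.comp (W.transAlgHom T).toRingHom).comp
      (W.galFunctionField σ).symm.toRingHom with
    commutes' := fun c ↦ by
      change W.galFunctionField σ (W.transAlgHom T ((W.galFunctionField σ).symm
        (algebraMap (AlgebraicClosure K) W.geomFunctionField c))) = _
      rw [galFunctionField_symm_algebraMap_base, AlgHom.commutes,
        galFunctionField_algebraMap_base, ← galRingHom_mul_apply, mul_inv_cancel, galRingHom_apply,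
        one_smul] }

/-- `conjTransAlgHom` unfolds. [folklore] -/
private theorem conjTransAlgHom_apply (σ : Field.absoluteGaloisGroup K) (T : W.geomPoints)
    (z : W.geomFunctionField) :
    W.conjTransAlgHom σ T z = W.galFunctionField σ (W.transAlgHom T ((W.galFunctionField σ).symm z)) :=
  rfl

/-- **`σ̃ ∘ τ_T^* = τ_{σT}^* ∘ σ̃`** (`σ̃ τ_T^* σ̃⁻¹` is the `K̄`-algebra endomorphism mapping the
generic point to `(x, y) + σ T`). Silverman, *AEC*, III.3.6, II.§2. [folklore] -/
theorem galFunctionField_transAlgHom (σ : Field.absoluteGaloisGroup K) (T : W.geomPoints)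
    (z : W.geomFunctionField) :
    W.galFunctionField σ (W.transAlgHom T z) = W.transAlgHom (σ • T) (W.galFunctionField σ z) := by
  have key : W.conjTransAlgHom σ T = W.transAlgHom (σ • T) := by
    refine algHom_eq_of_map_genericPoint_eq ?_
    rw [map_transAlgHom_genericPoint]
    -- `map (σ̃ τ σ̃⁻¹) (x,y) = map σ̃ₐ (map τ (x, y))` since `σ̃⁻¹` fixes `(x, y)`
    have h1 : Affine.Point.map (W' := W) (W.conjTransAlgHom σ T) W.genericPoint =
        Affine.Point.map (W' := W) (W.galFunctionFieldAlgEquiv σ : W.geomFunctionField →ₐ[K]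
          W.geomFunctionField) (Affine.Point.map (W' := W) (W.transAlgHom T) W.genericPoint) := by
      rw [map_genericPoint, map_genericPoint, Affine.Point.map_some]
      simp only [Affine.Point.some.injEq, conjTransAlgHom_apply, galFunctionField_symm_genX,
        galFunctionField_symm_genY]
      exact ⟨rfl, rfl⟩
    rw [h1, map_transAlgHom_genericPoint, map_add, map_galFunctionFieldAlgEquiv_genericPoint,
      map_galFunctionFieldAlgEquiv_constPoint]
  have := congrArg (fun φ ↦ φ (W.galFunctionField σ z)) key
  simp only [conjTransAlgHom_apply, RingEquiv.symm_apply_apply] at this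
  exact this

end Translations

end WeierstrassCurve

/-! # Section 2. The Weil pairing -/

namespace WeierstrassCurve

open geomPoints Literature.NumberTheory.EllipticCurves.WeierstrassFunctionField

variable {F : Type u} [Field F] {W : WeierstrassCurve F} {m : ℕ}

/-! ## The indicator of `E[m]` and Weil functions -/

section WeilFunction

variable (W m) in
/-- The indicator `𝟙_{E[m]}(Q) ∈ ℤ` of the `m`-torsion of `E(F̄)`. [folklore] -/
def torsionInd (Q : W.geomPoints) : ℤ := if (m : ℤ) • Q = 0 then 1 else 0

/-- `𝟙_{E[m]}(Q) = 1` on `E[m]`. [folklore] -/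
theorem torsionInd_of_eq {Q : W.geomPoints} (h : (m : ℤ) • Q = 0) : torsionInd W m Q = 1 :=
  if_pos h

/-- `𝟙_{E[m]}(Q) = 0` off `E[m]`. [folklore] -/
theorem torsionInd_of_ne {Q : W.geomPoints} (h : (m : ℤ) • Q ≠ 0) : torsionInd W m Q = 0 :=
  if_neg h

/-- `𝟙_{E[m]}` is invariant under translation by `E[m]`. [folklore] -/
theorem torsionInd_add_of_eq (Q : W.geomPoints) {S : W.geomPoints} (hS : (m : ℤ) • S = 0) :
    torsionInd W m (Q + S) = torsionInd W m Q := by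
  unfold torsionInd
  rw [smul_add, hS, add_zero]

/-- `𝟙_{E[m]}(-Q) = 𝟙_{E[m]}(Q)`. [folklore] -/
theorem torsionInd_neg (Q : W.geomPoints) : torsionInd W m (-Q) = torsionInd W m Q := by
  unfold torsionInd
  rw [smul_neg, neg_eq_zero]

/-- `𝟙_{E[m]}(σ Q) = 𝟙_{E[m]}(Q)` for `σ ∈ Γ_F`. [folklore] -/
theorem torsionInd_smul (σ : Field.absoluteGaloisGroup F) (Q : W.geomPoints) :
    torsionInd W m (σ • Q) = torsionInd W m Q := by
  unfold torsionInd
  rw [smul_comm (m : ℤ) σ Q, smul_eq_zero_iff_eq]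

variable (W m) [W.IsElliptic] in
/-- **Weil functions.** `h ∈ F̄(E)^×` is a *Weil function for `T` (at level `m`)* if for some
`T'` with `m T' = T` its divisor is `div (h) = Σ_{R ∈ E[m]} (T' + R) - (R)`, i.e.
`ord_P (h) = 𝟙_{E[m]}(P - T') - 𝟙_{E[m]}(P)` for all `P`. This is the function `g = g_T` of
Silverman's construction of the Weil pairing (*AEC* III.§8, p. 93: "`div(g) = Σ_{R ∈ E[m]}
(T' + R) - (R)`"), characterised by its divisor instead of by `g^m = f ∘ [m]`.
[cite: SilvermanAEC2009, III.§8 (construction of e_m)] -/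
def IsWeilFunction (T : W.geomPoints) (h : W.geomFunctionField) : Prop :=
  h ≠ 0 ∧ ∃ T' : W.geomPoints, (m : ℤ) • T' = T ∧
    ∀ P : W.geomPoints, ord (W.baseChange (AlgebraicClosure F)).toAffine P h =
      torsionInd W m (P - T') - torsionInd W m P

end WeilFunction

section Helpers

variable [W.IsElliptic]

omit [W.IsElliptic] in
/-- Cancellation: `algebraMap c * h = algebraMap c' * h` with `h ≠ 0` forces `c = c'`. [folklore] -/
theorem algebraMap_mul_cancel {c c' : AlgebraicClosure F} {h : W.geomFunctionField} (hh : h ≠ 0)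
    (e : algebraMap (AlgebraicClosure F) W.geomFunctionField c * h =
      algebraMap (AlgebraicClosure F) W.geomFunctionField c' * h) : c = c' :=
  (algebraMap (AlgebraicClosure F) W.geomFunctionField).injective (mul_right_cancel₀ hh e)

/-- Orders of a product of translates indexed by any finite family of points. [folklore] -/
theorem ord_prod_transAlgHom_family {ι : Type*} (s : Finset ι) (pt : ι → W.geomPoints)
    {w : W.geomFunctionField} (hw : w ≠ 0) (P : W.geomPoints) :
    ord (W.baseChange (AlgebraicClosure F)).toAffine P (∏ i ∈ s, W.transAlgHom (pt i) w) =
      ∑ i ∈ s, ord (W.baseChange (AlgebraicClosure F)).toAffine (P + pt i) w := by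
  induction s using Finset.induction_on with
  | empty => simp [ord]
  | insert i s hi ih =>
    rw [Finset.prod_insert hi, Finset.sum_insert hi, ord_mul P, ih, ord_transAlgHom]
    · exact (map_ne_zero_iff _ (W.transAlgHom (pt i)).injective).mpr hw
    · exact Finset.prod_ne_zero_iff.mpr fun j _ ↦
        (map_ne_zero_iff _ (W.transAlgHom (pt j)).injective).mpr hw

/-- A product of translates of a non-zero function (any finite family) is non-zero. [folklore] -/
theorem prod_transAlgHom_family_ne_zero {ι : Type*} (s : Finset ι) (pt : ι → W.geomPoints)
    {w : W.geomFunctionField} (hw : w ≠ 0) : ∏ i ∈ s, W.transAlgHom (pt i) w ≠ 0 :=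
  Finset.prod_ne_zero_iff.mpr fun j _ ↦ (map_ne_zero_iff _ (W.transAlgHom (pt j)).injective).mpr hw

end Helpers

section Construction

variable [W.IsElliptic] (hm : (m : F) ≠ 0)
include hm

omit [W.IsElliptic] in
/-- `m ≠ 0` in `F̄` (proof-local). [folklore] -/
private theorem natCast_algebraicClosure_ne_zero : ((m : ℕ) : AlgebraicClosure F) ≠ 0 := fun h ↦ hm (by
  have : algebraMap F (AlgebraicClosure F) (m : F) = 0 := by rwa [map_natCast]
  exact (map_eq_zero _).mp this)

omit [W.IsElliptic] in
/-- `m ≠ 0` in `ℤ` (proof-local). [folklore] -/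
private theorem intCast_ne_zero' : (m : ℤ) ≠ 0 := by
  rintro h
  have h0 : m = 0 := Int.natCast_eq_zero.mp h
  exact hm (by rw [h0, Nat.cast_zero])

omit [W.IsElliptic] in
/-- `(m : ℤ) ≠ 0` in `F` (proof-local). [folklore] -/
private theorem intCast_cast_ne_zero : ((m : ℤ) : F) ≠ 0 := by
  rwa [Int.cast_natCast]

/-- `E[m]` is finite (the tree's `finite_geomTorsion`). [folklore] -/
theorem finite_setOf_torsion : {R : W.geomPoints | (m : ℤ) • R = 0}.Finite :=
  (finite_geomTorsion W (intCast_ne_zero' hm)).subset fun R hR ↦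
    (mem_torsionPoints_iff _ _ R).mpr hR

/-- `E[m]` as a `Finset` of geometric points: the tree's subgroup `geomTorsion W m`, repackaged
through `Set.Finite.toFinset` for the sums and products below (the curve is implicit, so call
sites write `torsionFinset (W := W) hm`). [folklore] -/
def torsionFinset : Finset W.geomPoints := (finite_setOf_torsion (W := W) hm).toFinset

/-- Membership in `torsionFinset`. [folklore] -/
@[simp] theorem mem_torsionFinset {R : W.geomPoints} :
    R ∈ torsionFinset (W := W) hm ↔ (m : ℤ) • R = 0 := by
  rw [torsionFinset, Set.Finite.mem_toFinset, Set.mem_setOf_eq]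

/-- **`#E[m] = m²`** (the tree's `card_torsionPoints_eq_sq_holds`, Silverman *AEC* III.6.4(b)).
[cite: SilvermanAEC2009, Cor. III.6.4(b)] -/
theorem card_torsionFinset : (torsionFinset (W := W) hm).card = m ^ 2 := by
  have h := card_torsionPoints_eq_sq_holds W (AlgebraicClosure F)
    (natCast_algebraicClosure_ne_zero hm)
  have h' : Nat.card (geomTorsion W m) = Nat.card {R : W.geomPoints | (m : ℤ) • R = 0} :=
    Nat.card_congr (Equiv.subtypeEquivRight fun R ↦ mem_torsionPoints_iff _ _ R)
  rw [torsionFinset, ← Set.ncard_eq_toFinset_card _ (finite_setOf_torsion hm), ← Nat.card_coe_set_eq,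
    ← h']
  exact h

/-- `Σ_{R ∈ E[m]} [P = A + R] = 𝟙_{E[m]}(P - A)`. [folklore] -/
theorem sum_ite_eq_add (P A : W.geomPoints) :
    ∑ R ∈ torsionFinset (W := W) hm, (if P = A + R then (1 : ℤ) else 0) =
      torsionInd W m (P - A) := by
  have : ∀ R : W.geomPoints, (P = A + R) ↔ (P - A = R) := fun R ↦ by
    rw [sub_eq_iff_eq_add']
  simp_rw [this, Finset.sum_ite_eq, mem_torsionFinset]
  rfl

/-- `Σ_{R ∈ E[m]} [P = R] = 𝟙_{E[m]}(P)`. [folklore] -/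
theorem sum_ite_eq_self (P : W.geomPoints) :
    ∑ R ∈ torsionFinset (W := W) hm, (if P = R then (1 : ℤ) else 0) = torsionInd W m P := by
  simp_rw [Finset.sum_ite_eq, mem_torsionFinset]
  rfl

/-- `Σ_{R ∈ E[m]} [P + R = A] = 𝟙_{E[m]}(P - A)`. [folklore] -/
theorem sum_ite_add_eq (P A : W.geomPoints) :
    ∑ R ∈ torsionFinset (W := W) hm, (if P + R = A then (1 : ℤ) else 0) =
      torsionInd W m (P - A) := by
  have : ∀ R : W.geomPoints, (P + R = A) ↔ (A - P = R) := fun R ↦ by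
    rw [sub_eq_iff_eq_add', eq_comm]
  simp_rw [this, Finset.sum_ite_eq, mem_torsionFinset]
  rw [← torsionInd_neg, neg_sub]
  rfl

/-- Re-indexing a product over `E[m]` by a translation `R ↦ S + R`, `S ∈ E[m]`. [folklore] -/
theorem prod_torsionFinset_add_left {M : Type*} [CommMonoid M] {S : W.geomPoints}
    (hS : (m : ℤ) • S = 0) (f : W.geomPoints → M) :
    ∏ R ∈ torsionFinset (W := W) hm, f (S + R) = ∏ R ∈ torsionFinset (W := W) hm, f R := by
  refine Finset.prod_nbij' (fun R ↦ S + R) (fun R ↦ R - S) ?_ ?_ ?_ ?_ ?_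
  · intro R hR
    rw [mem_torsionFinset] at hR ⊢
    rw [smul_add, hS, hR, add_zero]
  · intro R hR
    rw [mem_torsionFinset] at hR ⊢
    rw [smul_sub, hS, hR, sub_zero]
  · intro R _; exact add_sub_cancel_left S R
  · intro R _; exact add_sub_cancel S R
  · intro R _; rfl

/-- **Existence of Weil functions** for `T ∈ E[m]`: choose `T'` with `m T' = T` (`[m]` is onto,
`zsmul_geomPoints_surjective_holds`); the divisor `Σ_{R ∈ E[m]} (T' + R) - (R)` has degree `0`
and sum `#E[m] · T' = m² T' = m T = O`, so it is principal (`exists_ord_eq_of_pairs`, Silverman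
*AEC* Cor. III.3.5). Silverman, *AEC* III.§8, p. 93. [cite: SilvermanAEC2009, III.§8 (construction of e_m)] -/
theorem exists_isWeilFunction {T : W.geomPoints} (hT : (m : ℤ) • T = 0) :
    ∃ h, IsWeilFunction W m T h := by
  obtain ⟨T', hT'⟩ := zsmul_geomPoints_surjective_holds W (intCast_ne_zero' hm) T
  change (m : ℤ) • T' = T at hT'
  have hsum : ∑ R ∈ torsionFinset (W := W) hm, (T' + R - R) = 0 := by
    simp_rw [add_sub_cancel_right, Finset.sum_const, card_torsionFinset hm]
    rw [pow_two, mul_nsmul, ← natCast_zsmul, ← natCast_zsmul, hT']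
    exact_mod_cast hT
  obtain ⟨u, hu0, hu⟩ := exists_ord_eq_of_pairs (torsionFinset (W := W) hm) (fun R ↦ T' + R)
    (fun R ↦ R) hsum
  refine ⟨u, hu0, T', hT', fun P ↦ ?_⟩
  rw [hu P, Finset.sum_sub_distrib, sum_ite_eq_add hm, sum_ite_eq_self hm]

omit hm in
/-- The order of a Weil function is invariant under `E[m]`-translations of the point. [folklore] -/
theorem IsWeilFunction.ord_add {T : W.geomPoints} {h : W.geomFunctionField}
    (hh : IsWeilFunction W m T h) (P : W.geomPoints) {S : W.geomPoints} (hS : (m : ℤ) • S = 0) :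
    ord (W.baseChange (AlgebraicClosure F)).toAffine (P + S) h =
      ord (W.baseChange (AlgebraicClosure F)).toAffine P h := by
  obtain ⟨-, T', -, hord⟩ := hh
  rw [hord, hord, show P + S - T' = P - T' + S by abel, torsionInd_add_of_eq _ hS,
    torsionInd_add_of_eq _ hS]

omit hm in
/-- **`τ_S^* h / h` is a non-zero constant** for a Weil function `h` and `S ∈ E[m]` (the divisor of
`h` is `E[m]`-invariant, and functions with the same divisor are proportional). Silverman, *AEC*
III.§8, p. 94 (`g(X + S)/g(X)` is constant). [cite: SilvermanAEC2009, III.§8 (construction of e_m)] -/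
theorem IsWeilFunction.exists_transAlgHom_eq {T : W.geomPoints} {h : W.geomFunctionField}
    (hh : IsWeilFunction W m T h) {S : W.geomPoints} (hS : (m : ℤ) • S = 0) :
    ∃ c : AlgebraicClosure F, c ≠ 0 ∧
      W.transAlgHom S h = algebraMap (AlgebraicClosure F) W.geomFunctionField c * h :=
  exists_eq_smul_of_ord_eq hh.1 ((map_ne_zero_iff _ (W.transAlgHom S).injective).mpr hh.1)
    fun P ↦ by rw [ord_transAlgHom, hh.ord_add P hS]

omit hm in
/-- **Weil functions for `T` are unique up to a non-zero constant** (two choices of `T'` differ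
by an element of `E[m]`, so the divisors agree). [folklore] -/
theorem IsWeilFunction.exists_eq_mul {T : W.geomPoints} {h h' : W.geomFunctionField}
    (hh : IsWeilFunction W m T h) (hh' : IsWeilFunction W m T h') :
    ∃ a : AlgebraicClosure F, a ≠ 0 ∧
      h' = algebraMap (AlgebraicClosure F) W.geomFunctionField a * h := by
  obtain ⟨h0, T', hT', hord⟩ := hh
  obtain ⟨h0', T'', hT'', hord'⟩ := hh'
  refine exists_eq_smul_of_ord_eq h0 h0' fun P ↦ ?_
  have hdiff : (m : ℤ) • (T' - T'') = 0 := by rw [smul_sub, hT', hT'', sub_self]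
  rw [hord, hord', show P - T'' = P - T' + (T' - T'') by abel, torsionInd_add_of_eq _ hdiff]

/-- A chosen Weil function for `T ∈ E[m]`. [folklore] -/
def weilFn {T : W.geomPoints} (hT : (m : ℤ) • T = 0) : W.geomFunctionField :=
  (exists_isWeilFunction hm hT).choose

/-- The chosen Weil function is a Weil function. [folklore] -/
theorem isWeilFunction_weilFn {T : W.geomPoints} (hT : (m : ℤ) • T = 0) :
    IsWeilFunction W m T (weilFn hm hT) :=
  (exists_isWeilFunction hm hT).choose_spec

/-- **The Weil pairing function** `e(S, T) ∈ F̄` for `S, T ∈ E[m]`: the constant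
`τ_S^* h_T / h_T` for the chosen Weil function `h_T` of `T` (junk value `1` off `E[m] × E[m]`).
This is Silverman's `e_m(S, T) = g(X + S)/g(X)` (*AEC* III.§8, p. 94).
[cite: SilvermanAEC2009, III.§8 (definition of e_m)] -/
def weilPairingFun (S T : W.geomPoints) : AlgebraicClosure F :=
  if hST : (m : ℤ) • S = 0 ∧ (m : ℤ) • T = 0 then
    ((isWeilFunction_weilFn hm hST.2).exists_transAlgHom_eq hST.1).choose
  else 1

/-- Defining property of `weilPairingFun` on the chosen Weil function. [folklore] -/
theorem transAlgHom_weilFn {S T : W.geomPoints} (hS : (m : ℤ) • S = 0) (hT : (m : ℤ) • T = 0) :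
    W.transAlgHom S (weilFn hm hT) =
      algebraMap (AlgebraicClosure F) W.geomFunctionField (weilPairingFun hm S T) * weilFn hm hT := by
  have hST : (m : ℤ) • S = 0 ∧ (m : ℤ) • T = 0 := ⟨hS, hT⟩
  rw [weilPairingFun, dif_pos hST]
  exact ((isWeilFunction_weilFn hm hST.2).exists_transAlgHom_eq hST.1).choose_spec.2

/-- **`τ_S^* h = e(S, T) · h` for every Weil function `h` of `T`** (not only the chosen one).
[folklore] -/
theorem IsWeilFunction.transAlgHom_eq {S T : W.geomPoints} {h : W.geomFunctionField}
    (hh : IsWeilFunction W m T h) (hS : (m : ℤ) • S = 0) (hT : (m : ℤ) • T = 0) :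
    W.transAlgHom S h =
      algebraMap (AlgebraicClosure F) W.geomFunctionField (weilPairingFun hm S T) * h := by
  obtain ⟨a, -, rfl⟩ := (isWeilFunction_weilFn hm hT).exists_eq_mul hh
  rw [map_mul, AlgHom.commutes, transAlgHom_weilFn hm hS hT]
  ring

/-! ### Bilinearity in `S`, values in `μ_m` -/

/-- **`e(S₁ + S₂, T) = e(S₁, T) e(S₂, T)`** (`τ_{S₁+S₂}^* = τ_{S₁}^* ∘ τ_{S₂}^*`). Silverman, *AEC*,
Prop. III.8.1(a), linearity in the first variable. [cite: SilvermanAEC2009, Prop. III.8.1(a)] -/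
theorem weilPairingFun_add_left {S₁ S₂ T : W.geomPoints} (hS₁ : (m : ℤ) • S₁ = 0)
    (hS₂ : (m : ℤ) • S₂ = 0) (hT : (m : ℤ) • T = 0) :
    weilPairingFun hm (S₁ + S₂) T = weilPairingFun hm S₁ T * weilPairingFun hm S₂ T := by
  have hh := isWeilFunction_weilFn hm hT
  have hS₁₂ : (m : ℤ) • (S₁ + S₂) = 0 := by rw [smul_add, hS₁, hS₂, add_zero]
  have h1 := hh.transAlgHom_eq hm hS₁₂ hT
  rw [transAlgHom_add, AlgHom.comp_apply, hh.transAlgHom_eq hm hS₂ hT, map_mul, AlgHom.commutes,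
    hh.transAlgHom_eq hm hS₁ hT, ← mul_assoc, ← map_mul, mul_comm (weilPairingFun hm S₂ T)] at h1
  exact (algebraMap_mul_cancel hh.1 h1).symm

/-- **`e(O, T) = 1`.** [folklore] -/
theorem weilPairingFun_zero_left {T : W.geomPoints} (hT : (m : ℤ) • T = 0) :
    weilPairingFun hm 0 T = 1 := by
  have hh := isWeilFunction_weilFn hm hT
  have h1 := hh.transAlgHom_eq hm (smul_zero _) hT
  rw [transAlgHom_zero, AlgHom.id_apply] at h1
  refine (algebraMap_mul_cancel hh.1 ?_).symm
  rw [map_one, one_mul]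
  exact h1

/-- `e(n S, T) = e(S, T)^n`. [folklore] -/
theorem weilPairingFun_nsmul_left {S T : W.geomPoints} (hS : (m : ℤ) • S = 0)
    (hT : (m : ℤ) • T = 0) (n : ℕ) :
    weilPairingFun hm (n • S) T = weilPairingFun hm S T ^ n := by
  induction n with
  | zero => rw [zero_nsmul, pow_zero, weilPairingFun_zero_left hm hT]
  | succ n ih =>
    have hnS : (m : ℤ) • (n • S) = 0 := by rw [← natCast_zsmul, smul_comm, hS, smul_zero]
    rw [succ_nsmul, weilPairingFun_add_left hm hnS hS hT, ih, pow_succ]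

/-- **`e(S, T)^m = 1`**: the values are `m`-th roots of unity. Silverman, *AEC*, III.§8
(`e_m : E[m] × E[m] → μ_m`). [cite: SilvermanAEC2009, III.§8 (definition of e_m)] -/
theorem weilPairingFun_pow {S T : W.geomPoints} (hS : (m : ℤ) • S = 0) (hT : (m : ℤ) • T = 0) :
    weilPairingFun hm S T ^ m = 1 := by
  rw [← weilPairingFun_nsmul_left hm hS hT, ← natCast_zsmul, hS, weilPairingFun_zero_left hm hT]

/-! ### Bilinearity in `T` -/

/-- **The norm `N(w) = ∏_{R ∈ E[m]} τ_R^* w` is `E[m]`-invariant**: `τ_S^* N(w) = N(w)`.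
[folklore] -/
theorem transAlgHom_prod_torsionFinset {S : W.geomPoints} (hS : (m : ℤ) • S = 0)
    (w : W.geomFunctionField) :
    W.transAlgHom S (∏ R ∈ torsionFinset (W := W) hm, W.transAlgHom R w) =
      ∏ R ∈ torsionFinset (W := W) hm, W.transAlgHom R w := by
  rw [map_prod]
  simp_rw [← AlgHom.comp_apply, ← transAlgHom_add]
  exact prod_torsionFinset_add_left hm hS fun R ↦ W.transAlgHom R w

/-- **Weil functions multiply**: if `h₁, h₂` are Weil functions for `T₁, T₂` with roots `T₁', T₂'`
and `div (w) = (T₁' + T₂') - (T₁') - (T₂') + (O)`, then `h₁ h₂ N(w)` is a Weil function for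
`T₁ + T₂` (with root `T₁' + T₂'`). This replaces Silverman's `f₃ = c f₁ f₂ h^m` / `g₃ = c' g₁ g₂
(h ∘ [m])` (*AEC* III.§8, proof of Prop. 8.1(a)) by the norm `N(w)` of `w`, avoiding `[m]^*`.
[cite: SilvermanAEC2009, Prop. III.8.1(a) (proof)] -/
theorem exists_isWeilFunction_add {T₁ T₂ : W.geomPoints} {h₁ h₂ : W.geomFunctionField}
    (hh₁ : IsWeilFunction W m T₁ h₁) (hh₂ : IsWeilFunction W m T₂ h₂) :
    ∃ N : W.geomFunctionField, N ≠ 0 ∧ (∀ S, (m : ℤ) • S = 0 → W.transAlgHom S N = N) ∧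
      IsWeilFunction W m (T₁ + T₂) (h₁ * h₂ * N) := by
  obtain ⟨h0₁, T₁', hT₁', hord₁⟩ := hh₁
  obtain ⟨h0₂, T₂', hT₂', hord₂⟩ := hh₂
  -- `w` with `div w = (T₁' + T₂') - (T₁') - (T₂') + (O)`
  obtain ⟨w, hw0, hw⟩ := exists_ord_eq_of_pairs (W := W) (Finset.univ : Finset Bool)
    (fun b ↦ cond b (T₁' + T₂') 0) (fun b ↦ cond b T₁' T₂')
    (by rw [Fintype.sum_bool]; simp only [cond_true, cond_false]; abel)
  have hwP : ∀ Q : W.geomPoints, ord (W.baseChange (AlgebraicClosure F)).toAffine Q w =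
      ((if Q = T₁' + T₂' then 1 else 0) - (if Q = T₁' then 1 else 0)) +
        ((if Q = 0 then 1 else 0) - (if Q = T₂' then 1 else 0)) := fun Q ↦ by
    rw [hw Q, Fintype.sum_bool]
    rfl
  set N := ∏ R ∈ torsionFinset (W := W) hm, W.transAlgHom R w with hN
  have hN0 : N ≠ 0 := prod_transAlgHom_family_ne_zero _ _ hw0
  refine ⟨N, hN0, fun S hS ↦ transAlgHom_prod_torsionFinset hm hS w, mul_ne_zero
    (mul_ne_zero h0₁ h0₂) hN0, T₁' + T₂', by rw [smul_add, hT₁', hT₂'], fun P ↦ ?_⟩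
  have hordN : ord (W.baseChange (AlgebraicClosure F)).toAffine P N =
      torsionInd W m (P - (T₁' + T₂')) - torsionInd W m (P - T₁') +
        (torsionInd W m P - torsionInd W m (P - T₂')) := by
    rw [hN, ord_prod_transAlgHom_family _ _ hw0]
    simp_rw [hwP]
    rw [Finset.sum_add_distrib, Finset.sum_sub_distrib, Finset.sum_sub_distrib, sum_ite_add_eq hm,
      sum_ite_add_eq hm, sum_ite_add_eq hm, sum_ite_add_eq hm, sub_zero]
  rw [ord_mul P (mul_ne_zero h0₁ h0₂) hN0, ord_mul P h0₁ h0₂, hord₁, hord₂, hordN]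
  ring

/-- **`e(S, T₁ + T₂) = e(S, T₁) e(S, T₂)`.** Silverman, *AEC*, Prop. III.8.1(a), linearity in the
second variable. [cite: SilvermanAEC2009, Prop. III.8.1(a)] -/
theorem weilPairingFun_add_right {S T₁ T₂ : W.geomPoints} (hS : (m : ℤ) • S = 0)
    (hT₁ : (m : ℤ) • T₁ = 0) (hT₂ : (m : ℤ) • T₂ = 0) :
    weilPairingFun hm S (T₁ + T₂) = weilPairingFun hm S T₁ * weilPairingFun hm S T₂ := by
  have hh₁ := isWeilFunction_weilFn hm hT₁
  have hh₂ := isWeilFunction_weilFn hm hT₂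
  obtain ⟨N, hN0, hNinv, hh⟩ := exists_isWeilFunction_add hm hh₁ hh₂
  have hT₁₂ : (m : ℤ) • (T₁ + T₂) = 0 := by rw [smul_add, hT₁, hT₂, add_zero]
  have h1 := hh.transAlgHom_eq hm hS hT₁₂
  rw [map_mul, map_mul, hNinv S hS, hh₁.transAlgHom_eq hm hS hT₁, hh₂.transAlgHom_eq hm hS hT₂]
    at h1
  refine (algebraMap_mul_cancel hh.1 ?_).symm
  rw [map_mul, ← h1]
  ring

/-! ### `e(T, T) = 1` -/

/-- **`e(T, T) = 1`** (Silverman, *AEC*, Prop. III.8.1(b)): with `h` a Weil function for `T`, root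
`T'`, the product `H = ∏_{i<m} τ_{iT'}^* h` has divisor `Σ_i (𝟙_{E[m]}(P + (i-1)T') -
𝟙_{E[m]}(P + iT'))`, a telescoping sum equal to `0` because `mT' = T ∈ E[m]`; so `H` is constant,
`τ_{T'}^* H = H`, while `τ_{T'}^* H = H · τ_T^* h / h = e(T, T) H`.
[cite: SilvermanAEC2009, Prop. III.8.1(b) (proof)] -/
theorem weilPairingFun_self {T : W.geomPoints} (hT : (m : ℤ) • T = 0) :
    weilPairingFun hm T T = 1 := by
  have hh := isWeilFunction_weilFn hm hT
  set h := weilFn hm hT with hh_def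
  obtain ⟨h0, T', hT', hord⟩ := hh
  set H := ∏ i ∈ Finset.range m, W.transAlgHom (i • T') h with hH
  have hH0 : H ≠ 0 := prod_transAlgHom_family_ne_zero _ _ h0
  -- `div H = 0`
  have hordH : ∀ P : W.geomPoints, ord (W.baseChange (AlgebraicClosure F)).toAffine P H = 0 := by
    intro P
    rw [hH, ord_prod_transAlgHom_family _ _ h0]
    simp_rw [hord]
    have htel : ∀ i ∈ Finset.range m,
        torsionInd W m (P + i • T' - T') - torsionInd W m (P + i • T') =
          torsionInd W m (P + i • T' - T') - torsionInd W m (P + (i + 1) • T' - T') := by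
      intro i _
      rw [succ_nsmul, ← add_assoc, add_sub_cancel_right]
    rw [Finset.sum_congr rfl htel, Finset.sum_range_sub', zero_nsmul, add_zero,
      ← natCast_zsmul, hT', show P + T - T' = P - T' + T by abel, torsionInd_add_of_eq _ hT,
      sub_self]
  obtain ⟨c, hc⟩ := exists_eq_algebraMap_of_ord_nonneg (W := W) (u := H) fun P ↦ (hordH P).ge
  -- `τ_{T'}^* H = H`
  have hfix : W.transAlgHom T' H = H := by rw [← hc, AlgHom.commutes]
  -- `τ_{T'}^* H · h = H · τ_T^* h`
  have hshift : W.transAlgHom T' H * h = H * W.transAlgHom T h := by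
    have e1 : W.transAlgHom T' H = ∏ i ∈ Finset.range m, W.transAlgHom ((i + 1) • T') h := by
      rw [hH, map_prod]
      refine Finset.prod_congr rfl fun i _ ↦ ?_
      rw [← AlgHom.comp_apply, ← transAlgHom_add, succ_nsmul']
    have e2 : (∏ i ∈ Finset.range m, W.transAlgHom ((i + 1) • T') h) * W.transAlgHom ((0 : ℕ) • T') h
        = H * W.transAlgHom (m • T') h := by
      rw [hH, ← Finset.prod_range_succ, Finset.prod_range_succ']
    rw [zero_nsmul, transAlgHom_zero, AlgHom.id_apply, ← natCast_zsmul, hT'] at e2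
    rw [e1, e2]
  rw [hfix, IsWeilFunction.transAlgHom_eq hm ⟨h0, T', hT', hord⟩ hT hT] at hshift
  -- `H h = e · (H h)`
  have hHh : H * h ≠ 0 := mul_ne_zero hH0 h0
  have key : algebraMap (AlgebraicClosure F) W.geomFunctionField 1 * (H * h) =
      algebraMap (AlgebraicClosure F) W.geomFunctionField (weilPairingFun hm T T) * (H * h) := by
    rw [map_one, one_mul]
    calc H * h = H * (algebraMap (AlgebraicClosure F) W.geomFunctionField (weilPairingFun hm T T) * h) :=
          hshift
      _ = algebraMap (AlgebraicClosure F) W.geomFunctionField (weilPairingFun hm T T) * (H * h) := by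
          ring
  exact (algebraMap_mul_cancel hHh key).symm

/-! ### Non-degeneracy -/

/-- **Non-degeneracy** (Silverman, *AEC*, Prop. III.8.1(c)): if `e(S, T) = 1` for all `S ∈ E[m]`
then `T = O`. Proof: the Weil function `h` of `T` is then fixed by all `τ_S^*`, `S ∈ E[m]`, so lies
in `K̄(E)^{E[m]} = [m]^* K̄(E)` (the tree's `Isogeny.pullbackField_zsmul_eq_fixedField`, *AEC*
III.4.10(b)): `h = [m]^* Fn`. Comparing orders along `[m]` (`ord_P([m]^* Fn) = e ord_{mP}(Fn)`,
`exists_ord_pullbackHom_zsmul`) shows `div (Fn) = (T) - (O)`, which forces `T = O`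
(`eq_zero_of_ord_eq_single`, *AEC* III.3.3). [cite: SilvermanAEC2009, Prop. III.8.1(c) (proof)] -/
theorem eq_zero_of_weilPairingFun_eq_one {T : W.geomPoints} (hT : (m : ℤ) • T = 0)
    (h1 : ∀ S : W.geomPoints, (m : ℤ) • S = 0 → weilPairingFun hm S T = 1) : T = 0 := by
  have hh := isWeilFunction_weilFn hm hT
  set h := weilFn hm hT with hh_def
  have hmZ : (m : ℤ) ≠ 0 := intCast_ne_zero' hm
  -- `h` is fixed by the `E[m]`-translations
  have hfix : ∀ S : W.geomPoints, (m : ℤ) • S = 0 → W.transAlgHom S h = h := fun S hS ↦ by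
    rw [hh.transAlgHom_eq hm hS hT, h1 S hS, map_one, one_mul]
  have hmem : h ∈ (Isogeny.zsmul W (m : ℤ) hmZ).pullbackField := by
    rw [Isogeny.pullbackField_zsmul_eq_fixedField hmZ (intCast_cast_ne_zero hm),
      IntermediateField.mem_fixedField_iff]
    rintro f hf
    obtain ⟨g, hg, rfl⟩ := Subgroup.mem_map.mp hf
    rw [transHom_apply]
    exact hfix _ ((mem_torsionPoints_iff _ _ _).mp hg)
  obtain ⟨Fn, hFn⟩ := ((Isogeny.zsmul W (m : ℤ) hmZ).mem_pullbackField_iff h).mp hmem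
  have hFn0 : Fn ≠ 0 := by
    rintro rfl
    exact hh.1 (by rw [← hFn, map_zero])
  obtain ⟨h0, T', hT', hord⟩ := hh
  -- the divisor of `Fn` off `O`
  have hdiv : ∀ Q : W.geomPoints, Q ≠ 0 →
      ord (W.baseChange (AlgebraicClosure F)).toAffine Q Fn = if Q = T then 1 else 0 := by
    intro Q hQ
    obtain ⟨P, hP⟩ := zsmul_geomPoints_surjective_holds W hmZ Q
    change (m : ℤ) • P = Q at hP
    have hP0 : (m : ℤ) • P ≠ 0 := hP ▸ hQ
    obtain ⟨e, he, hepull⟩ := exists_ord_pullbackHom_zsmul hmZ hP0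
    have key := hepull Fn hFn0
    rw [hFn, hP, hord P, torsionInd_of_ne hP0, sub_zero] at key
    -- `𝟙_{E[m]}(P - T') = [Q = T]`
    have hind : torsionInd W m (P - T') = if Q = T then 1 else 0 := by
      unfold torsionInd
      rw [smul_sub, hP, hT', sub_eq_zero]
    rw [hind] at key
    split_ifs at key ⊢ with hQT
    · have he1 : (e : ℤ) = 1 := Int.eq_one_of_mul_eq_one_right (by positivity) key.symm
      rw [he1, one_mul] at key
      exact key.symm
    · rcases mul_eq_zero.mp key.symm with he0 | h0'
      · exact absurd he0 (by exact_mod_cast (by omega : e ≠ 0))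
      · exact h0'
  exact eq_zero_of_ord_eq_single hFn0 hdiv

/-! ### Galois equivariance -/

omit hm in
/-- **`σ̃` of a Weil function for `T` is a Weil function for `σ T`** (root `σ T'`; `ord_{σP}(σ̃ h)
= ord_P(h)` and `σ` preserves `E[m]`). [folklore] -/
theorem IsWeilFunction.galFunctionField {T : W.geomPoints} {h : W.geomFunctionField}
    (hh : IsWeilFunction W m T h) (σ : Field.absoluteGaloisGroup F) :
    IsWeilFunction W m (σ • T) (W.galFunctionField σ h) := by
  obtain ⟨h0, T', hT', hord⟩ := hh
  refine ⟨(map_ne_zero_iff _ (W.galFunctionField σ).injective).mpr h0, σ • T',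
    by rw [smul_comm (m : ℤ) σ T', hT'], fun P ↦ ?_⟩
  have hP : P = σ • (σ⁻¹ • P) := (smul_inv_smul σ P).symm
  conv_lhs => rw [hP, ord_galFunctionField]
  rw [hord, show σ⁻¹ • P - T' = σ⁻¹ • (P - σ • T') by rw [smul_sub, inv_smul_smul],
    torsionInd_smul, torsionInd_smul]

/-- **Galois equivariance**: `e(σ S, σ T) = σ (e(S, T))` for `σ ∈ Γ_F` (Silverman, *AEC*,
Prop. III.8.1(d)): apply `σ̃` to `τ_S^* h = e(S,T) h` and use `σ̃ τ_S^* = τ_{σS}^* σ̃`.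
[cite: SilvermanAEC2009, Prop. III.8.1(d) (proof)] -/
theorem weilPairingFun_smul (σ : Field.absoluteGaloisGroup F) {S T : W.geomPoints}
    (hS : (m : ℤ) • S = 0) (hT : (m : ℤ) • T = 0) :
    weilPairingFun hm (σ • S) (σ • T) = σ • weilPairingFun hm S T := by
  have hh := isWeilFunction_weilFn hm hT
  have hσS : (m : ℤ) • (σ • S) = 0 := by rw [smul_comm (m : ℤ) σ S, hS, smul_zero]
  have hσT : (m : ℤ) • (σ • T) = 0 := by rw [smul_comm (m : ℤ) σ T, hT, smul_zero]
  have h1 := (hh.galFunctionField σ).transAlgHom_eq hm hσS hσT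
  rw [← galFunctionField_transAlgHom, hh.transAlgHom_eq hm hS hT, map_mul,
    galFunctionField_algebraMap_base, galRingHom_apply] at h1
  exact (algebraMap_mul_cancel ((map_ne_zero_iff _ (W.galFunctionField σ).injective).mpr hh.1)
    h1).symm

end Construction

/-! ## The discharge -/

/-- **The Weil pairing exists** (discharge of the named fact `WeierstrassCurve.exists_weilPairing`;
Silverman, *AEC*, III.§8, Prop. 8.1 (a)–(d)): for an elliptic curve `W` over a field `F` and
`m ≥ 2` invertible in `F`, the function `e(S, T) = τ_S^* h_T / h_T` on `E[m] × E[m]`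
(`weilPairingFun`), `h_T` a function with divisor `Σ_{R ∈ E[m]} (T' + R) - (R)`, `mT' = T`, takes
values in `μ_m` and is bilinear, alternating, non-degenerate and `Γ_F`-equivariant. (The
hypothesis `PerfectField F` of the named fact is not used.)
[cite: SilvermanAEC2009, Prop. III.8.1 (a)–(d)] -/
theorem exists_weilPairing_holds (W : WeierstrassCurve F) (m : ℕ) : W.exists_weilPairing m := by
  intro _ _ _ hm
  have mem : ∀ S : geomTorsion W m, (m : ℤ) • (S : W.geomPoints) = 0 := fun S ↦
    (mem_torsionPoints_iff _ _ (S : W.geomPoints)).mp S.2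
  refine ⟨fun S T ↦ weilPairingFun hm (S : W.geomPoints) (T : W.geomPoints),
    fun S T ↦ weilPairingFun_pow hm (mem S) (mem T),
    fun S₁ S₂ T ↦ weilPairingFun_add_left hm (mem S₁) (mem S₂) (mem T),
    fun S T₁ T₂ ↦ weilPairingFun_add_right hm (mem S) (mem T₁) (mem T₂),
    fun T ↦ weilPairingFun_self hm (mem T),
    fun T hT ↦ ?_,
    fun σ S T ↦ ?_⟩
  · have := eq_zero_of_weilPairingFun_eq_one hm (mem T) fun S hS ↦
      hT ⟨S, (mem_torsionPoints_iff _ _ S).mpr hS⟩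
    exact Subtype.ext this
  · change σ • weilPairingFun hm _ _ = weilPairingFun hm (σ • (S : W.geomPoints)) (σ • (T : W.geomPoints))
    exact (weilPairingFun_smul hm σ (mem S) (mem T)).symm

end WeierstrassCurve
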